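import Literature.MathematicalPhysics.QuantumFieldTheory.Balaban1983to89.B5Eq117CompositionV1
import Literature.MathematicalPhysics.QuantumFieldTheory.BalabanImbrieJaffe1984to88.BIJ85AxialMinimizer413

/-!
# `Balaban1983to89.B5Eq117FibreVolume` — the right-hand side of [Balaban1984PropagatorsI] (1.17) p. 20,
`∫dA δ(B − Q_kA)δ_Ax(Q_{k−1}A)⋯δ_Ax(A)ρ(A)`, IS the intrinsic Euclidean volume integral over the fibre, and (for `ρ = e^{−S}`) IS the
normalisation `Z_{k,Ax}(B) = ∫dA δ(Q_kA − B)δ_{k,Ax}(A)exp(−½‖∂A‖²)` of [BalabanImbrieJaffe1985] (4.1.4) p. 310 — a KNITTING file between the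
two V1 formalizations of one printed integral (coordinates `B9Eq3166.subInt`, seat p38's `B5Eq117CompositionV1.multiRT`; subspace volume
`∫ v : V411 P k`, seat p09's `BIJ85AxialMinimizer413.torusZax`)

statement-level skeleton of published theorems with citation tags; proofs where landed; nothing here is a claim about the Yang–Mills mass gap

PRINT, verbatim.  [Balaban1984PropagatorsI] p. 20: "`((ST)^k e^{−S})(B) = z^{(k)}∫dA δ(B − Q_kA)δ_Ax(Q_{k−1}A)·…·δ_Ax(A)e^{−S_η(A)}` (1.17)".
[BalabanImbrieJaffe1985] p. 310: "`Z_{k,Ax}(B) = ∫dA δ(Q_kA − B)δ_{k,Ax}(A)exp(−½‖∂A‖²)`. (4.1.4)".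

CITATION HEADER (lean-in-tree rule) — WHAT IS REPRODUCED.  Phase-2 file of the lit-balaban typed skeleton (HOME `run/shared/lean/pub/lit-balaban/`),
seat p38 (gen 2); rows `B5.Eq1.17` (V1 twin `B5Eq117CompositionV1`, this seat; fold owner r02) and `C1.Eq4.1.3-4.1.5` (seat p09).  The two seats
typed the SAME δ-constrained integral over the SAME affine subspace `{Q_kA = B, δ_{k,Ax}(A)}` of the V1 bond fields `VecField P 0 ℝ` in two
measure-theoretic dialects: `B9Eq3166.subInt N f = √det(NᵀN)·∫f(Nz)dz` in a basis matrix `N` of the direction space (p38, after p16/pv16), and the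
Bochner integral over the SUBTYPE of the direction space `V411 P k ⊂ BondSpace P` with the volume of its induced inner product (p09).  THIS FILE
PROVES THEY ARE EQUAL — the folklore fact that `√det(Gram)` times Lebesgue measure in coordinates is the Euclidean surface measure
(`subInt_eq_integral_submodule`, generic: any injective `N` and the submodule of `EuclideanSpace ℝ n` it spans) — and reads it on the carriers of
record: `multiRT k ρ B = ∫_{v ∈ V411} ρ(faceFieldIter k B + v)` (`multiRT_eq_integral_V411`), `multiRT k e^{−S} B = Z_{k,Ax}(faceFieldIter k B)`
(`multiRT_exp_eq_torusZax`, BIJ85 (4.1.4) ≙ the right side of B5 (1.17)), hence `((ST)^k e^{−S})(B) = z^{(k)}·Z_{k,Ax}(B)` with seat p09's `Z_{k,Ax}`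
(`eq117_torusZax`).  Nothing is re-declared; no new definitions.

Unit `lit-balaban-p38` (literature-prover-lit-balaban-p38-g2-0), 2026-08-21.
-/

open scoped BigOperators RealInnerProductSpace

namespace Literature.MathematicalPhysics.QuantumFieldTheory.Balaban1983to89

namespace B5Eq117FibreVolume

open MeasureTheory Matrix
open B9Eq3166 (subInt)
open B9Eq3170 (IsBasisOf)

noncomputable section

/-! ## 1. Generic: `√det(NᵀN)·∫ f(Nz) dz` is the volume integral over the subspace spanned by the columns of `N` -/

section Generic

variable {n τ : Type*} [Fintype n] [Fintype τ] [DecidableEq τ]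

/-- **SUBSPACE INTEGRAL IN COORDINATES = INTRINSIC VOLUME INTEGRAL.**  For an injective real matrix `N : ℝ^τ → ℝ^n` and the submodule `K` of the
Euclidean space `ℝ^n` spanned by its columns, `√det(NᵀN)·∫_{ℝ^τ} f(Nz) dz = ∫_K f dvol_K`, `vol_K` the volume measure of the inner product space `K`
(Mathlib's `measureSpaceOfInnerProductSpace`): an orthonormal basis `b` of `K` indexed by `τ` is volume preserving, and the matrix `M` of
`b.repr ∘ (z ↦ Nz)` has `MᵀM = NᵀN`, so `|det M| = √det(NᵀN)` is the Jacobian.  (Folklore measure theory; it is the content of reading the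
printed `∫dA δ(B − Q_kA)δ_Ax(Q_{k−1}A)⋯δ_Ax(A)…` of (1.17) either way.) [cite: Balaban1984PropagatorsI, (1.17) p.20] -/
theorem subInt_eq_integral_submodule (N : Matrix n τ ℝ) (hN : Function.Injective N.mulVec)
    (K : Submodule ℝ (EuclideanSpace ℝ n)) (hK : ∀ x : EuclideanSpace ℝ n, x ∈ K ↔ WithLp.ofLp x ∈ Set.range N.mulVec)
    (f : EuclideanSpace ℝ n → ℝ) :
    subInt N (fun v => f (WithLp.toLp 2 v)) = ∫ x : K, f (x : EuclideanSpace ℝ n) := by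
  -- (1) the parametrisation `z ↦ Nz` as a linear equivalence `(τ → ℝ) ≃ K`
  have hmem : ∀ u : τ → ℝ, WithLp.toLp 2 (N *ᵥ u) ∈ K := fun u => (hK _).2 ⟨u, rfl⟩
  let L : (τ → ℝ) →ₗ[ℝ] K :=
    LinearMap.codRestrict K ((WithLp.linearEquiv 2 ℝ (n → ℝ)).symm.toLinearMap ∘ₗ N.mulVecLin) hmem
  have hL : ∀ u, (L u : EuclideanSpace ℝ n) = WithLp.toLp 2 (N *ᵥ u) := fun u => rfl
  have hLinj : Function.Injective L := by
    intro u v h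
    have h' := congrArg (fun x : K => WithLp.ofLp (x : EuclideanSpace ℝ n)) h
    simp only [hL, WithLp.ofLp_toLp] at h'
    exact hN h'
  have hLsurj : Function.Surjective L := by
    intro x
    obtain ⟨u, hu⟩ := (hK x).1 x.2
    refine ⟨u, Subtype.ext ?_⟩
    rw [hL, hu, WithLp.toLp_ofLp]
  let eK : (τ → ℝ) ≃ₗ[ℝ] K := LinearEquiv.ofBijective L ⟨hLinj, hLsurj⟩
  have heK : ∀ u, (eK u : EuclideanSpace ℝ n) = WithLp.toLp 2 (N *ᵥ u) := fun u => rfl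
  -- (2) an orthonormal basis of `K` indexed by `τ`
  have hcard : Fintype.card τ = Module.finrank ℝ K := by
    rw [← Module.finrank_fintype_fun_eq_card (R := ℝ), eK.finrank_eq]
  let b : OrthonormalBasis τ ℝ K := (stdOrthonormalBasis ℝ K).reindex (Fintype.equivFinOfCardEq hcard).symm
  -- (3) the matrix `M` of `b.repr ∘ eK` in the standard bases
  let Ψ : (τ → ℝ) ≃ₗ[ℝ] (τ → ℝ) := (eK.trans b.repr.toLinearEquiv).trans (WithLp.linearEquiv 2 ℝ (τ → ℝ))
  have hΨ : ∀ u, WithLp.toLp 2 (Ψ u) = b.repr (eK u) := fun u => rfl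
  let M : Matrix τ τ ℝ := LinearMap.toMatrix' Ψ.toLinearMap
  have hM : ∀ u, M *ᵥ u = Ψ u := fun u => by
    rw [← Matrix.toLin'_apply, Matrix.toLin'_toMatrix']
    rfl
  have hMsymm : ∀ u, b.repr.symm (WithLp.toLp 2 (M *ᵥ u)) = eK u := fun u => by
    rw [hM, hΨ, LinearIsometryEquiv.symm_apply_apply]
  have hdetM : M.det ≠ 0 := by
    rw [LinearMap.det_toMatrix']
    exact (LinearEquiv.isUnit_det' Ψ).ne_zero
  -- (4) the Gram identity `MᵀM = NᵀN`
  have hMcol : ∀ (j i : τ), (M *ᵥ Pi.single j 1) i = M i j := by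
    intro j i
    simp [Matrix.mulVec, dotProduct, Pi.single_apply]
  have hNcol : ∀ (j : τ) (i : n), (N *ᵥ Pi.single j 1) i = N i j := by
    intro j i
    simp [Matrix.mulVec, dotProduct, Pi.single_apply]
  have hinner : ∀ j j' : τ, ⟪WithLp.toLp 2 (M *ᵥ Pi.single j 1), WithLp.toLp 2 (M *ᵥ Pi.single j' 1)⟫ =
      ⟪WithLp.toLp 2 (N *ᵥ Pi.single j 1), WithLp.toLp 2 (N *ᵥ Pi.single j' 1)⟫ := by
    intro j j'
    rw [hM, hM, hΨ, hΨ, LinearIsometryEquiv.inner_map_map, Submodule.coe_inner, heK, heK]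
  have hgram : Mᵀ * M = Nᵀ * N := by
    ext j j'
    have h := hinner j j'
    simp only [PiLp.inner_apply, hMcol, hNcol] at h
    simp only [Matrix.mul_apply, Matrix.transpose_apply]
    have h1 : ∀ (a c : ℝ), ⟪a, c⟫ = c * a := fun a c => by simp [mul_comm]
    simp only [h1] at h
    calc ∑ i, M i j * M i j' = ∑ i, M i j' * M i j := Finset.sum_congr rfl fun i _ => mul_comm _ _
      _ = ∑ i, N i j' * N i j := h
      _ = ∑ i, N i j * N i j' := Finset.sum_congr rfl fun i _ => mul_comm _ _
  have habs : |M.det| = Real.sqrt ((Nᵀ * N).det) := by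
    rw [← hgram, det_mul, det_transpose, ← sq, Real.sqrt_sq_eq_abs]
  -- (5) the chain of integrals
  have hI1 : ∫ x : K, f (x : EuclideanSpace ℝ n) = ∫ y : EuclideanSpace ℝ τ, f (b.repr.symm y : EuclideanSpace ℝ n) := by
    rw [← b.measurePreserving_measurableEquiv.symm.integral_comp']
    rfl
  have hI2 : ∫ y : EuclideanSpace ℝ τ, f (b.repr.symm y : EuclideanSpace ℝ n) =
      ∫ z : τ → ℝ, f (b.repr.symm (WithLp.toLp 2 z) : EuclideanSpace ℝ n) := by
    have h := (EuclideanSpace.volume_preserving_symm_measurableEquiv_toLp τ).integral_comp'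
      (fun z : τ → ℝ => f (b.repr.symm (WithLp.toLp 2 z) : EuclideanSpace ℝ n))
    simp only [MeasurableEquiv.toLp_symm_apply, WithLp.toLp_ofLp] at h
    exact h
  have hI3 : ∫ u : τ → ℝ, f (b.repr.symm (WithLp.toLp 2 (M *ᵥ u)) : EuclideanSpace ℝ n) =
      |M.det|⁻¹ * ∫ z : τ → ℝ, f (b.repr.symm (WithLp.toLp 2 z) : EuclideanSpace ℝ n) :=
    Beta.GaussianIntegral.integral_comp_mulVec M hdetM (fun z => f (b.repr.symm (WithLp.toLp 2 z) : EuclideanSpace ℝ n))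
  have habs0 : |M.det| ≠ 0 := abs_ne_zero.2 hdetM
  have hI4 : ∫ z : τ → ℝ, f (b.repr.symm (WithLp.toLp 2 z) : EuclideanSpace ℝ n) =
      |M.det| * ∫ u : τ → ℝ, f (WithLp.toLp 2 (N *ᵥ u)) := by
    have h5 : (fun u : τ → ℝ => f (b.repr.symm (WithLp.toLp 2 (M *ᵥ u)) : EuclideanSpace ℝ n)) =
        fun u => f (WithLp.toLp 2 (N *ᵥ u)) := by
      funext u
      rw [hMsymm, heK]
    rw [← h5, hI3, ← mul_assoc, mul_inv_cancel₀ habs0, one_mul]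
  unfold subInt
  rw [hI1, hI2, hI4, habs]

end Generic

/-! ## 2. On the carriers of record: the right side of (1.17) = the volume integral over BIJ85's `V` = BIJ85's `Z_{k,Ax}(B)` -/

section V1

open LatticeFieldCalculus B5Eq112RenormTransf B5Eq117CompositionV1
open Literature.MathematicalPhysics.QuantumFieldTheory.BalabanImbrieJaffe1984to88.BIJ85AxialPropagator411
  (constraint411 mem_constraint411 BondSpace toE V411 mem_V411)
open Literature.MathematicalPhysics.QuantumFieldTheory.BalabanImbrieJaffe1984to88.BIJ85AxialMinimizer413 (torusZax torusZax_eq)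

variable {P : Params}

/-- BIJ85's direction space `V = V411 P k` is the submodule of `BondSpace P` spanned by the columns of the basis matrix `kerBasisIter P k` of the
`k`-fold constraints. [cite: BalabanImbrieJaffe1985, (4.1.1) p.309] -/
theorem mem_V411_iff_range (k : ℕ) (x : BondSpace P) :
    x ∈ V411 P k ↔ WithLp.ofLp x ∈ Set.range (kerBasisIter P k).mulVec := by
  rw [mem_V411, ← mem_constraint411, ← SetLike.mem_coe, (isBasisOf_kerBasisIter (P := P) k).mem_iff, Set.mem_range]
  exact Iff.rfl

/-- **THE RIGHT-HAND SIDE OF (1.17) IS THE VOLUME INTEGRAL OVER THE FIBRE**: `∫dA δ(B − Q_kA)δ_Ax(Q_{k−1}A)⋯δ_Ax(A)ρ(A)` in coordinates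
(`multiRT`, `B9Eq3166.subInt`) equals the Bochner integral over BIJ85's subspace `V411 P k` (volume of its inner product) of
`v ↦ ρ(faceFieldIter k B + v)`. [cite: Balaban1984PropagatorsI, (1.17) p.20] -/
theorem multiRT_eq_integral_V411 (k : ℕ) (ρ : VecField P 0 ℝ → ℝ) (B : VecField P k ℝ) :
    multiRT k ρ B = ∫ v : V411 P k, ρ (faceFieldIter k B + (toE P).symm (v : BondSpace P)) := by
  rw [multiRT]
  exact subInt_eq_integral_submodule (kerBasisIter P k) (isBasisOf_kerBasisIter (P := P) k).inj (V411 P k)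
    (mem_V411_iff_range k) (fun x => ρ (faceFieldIter k B + (toE P).symm x))

/-- **B5 (1.17) right side ≙ BIJ85 (4.1.4)**: for the abelian action `S = ½Σ_p w|(∂A)(p)|²` (`w ≥ 0`),
`∫dA δ(B − Q_kA)δ_Ax(Q_{k−1}A)⋯δ_Ax(A)e^{−S(A)}` (`multiRT`, seat p38) `= Z_{k,Ax}(B)` (`BIJ85AxialMinimizer413.torusZax` of seat p09, at the
representative `faceFieldIter k B` of the fibre). [cite: BalabanImbrieJaffe1985, (4.1.4) p.310] -/
theorem multiRT_exp_eq_torusZax {w : ℝ} (hw : 0 ≤ w) (c : ℝ) (k : ℕ) (B : VecField P k ℝ) :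
    multiRT k (fun A => Real.exp (-curlAction w c A)) B = torusZax w c k (faceFieldIter k B) := by
  rw [multiRT_eq_integral_V411, torusZax_eq hw]

/-- **(1.17) with BIJ85's normalisation**: `((ST)^k e^{−S})(B) = z^{(k)}·Z_{k,Ax}(B)`, ONE `z^{(k)} > 0` for all `B` (`w > 0`, `c ≠ 0`,
`k ≤ m + K`). [cite: Balaban1984PropagatorsI, (1.17) p.20] -/
theorem eq117_torusZax {k : ℕ} (hk : k ≤ P.m + P.K) {w : ℝ} (hw : 0 < w) {c : ℝ} (hc : c ≠ 0) :
    ∃ z : ℝ, 0 < z ∧ ∀ B : VecField P k ℝ,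
      rtPow k (fun A => Real.exp (-curlAction w c A)) B = z * torusZax w c k (faceFieldIter k B) := by
  obtain ⟨z, hz, h⟩ := eq117_curlAction (P := P) hk hw hc
  exact ⟨z, hz, fun B => by rw [h B, multiRT_exp_eq_torusZax hw.le]⟩

end V1

end

end B5Eq117FibreVolume

end Literature.MathematicalPhysics.QuantumFieldTheory.Balaban1983to89
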